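import Summits.BirchSwinnertonDyer.BirchSwinnertonDyer.Theorems.EdixhovenFibreFiveSevenStarredOptimalManinUnitFiveSevenLeverAtCharacter57
import Summits.BirchSwinnertonDyer.BirchSwinnertonDyer.Theorems.AdditiveKolyvaginRoadManinFrameResidueProperRTameTwistSymbols57
import HarnessLib

/-!
# The tame-twist lever at `p ∈ {5, 7}` RE-KEYED PER CURVE, II: `Im {∞, γ∞}_f / |Ω⁻(W)|` is `p`-integral for every
# `γ ∈ Γ₀(N)`, from the body of F″ AT `(W, p)` (no universal Kato fact)

HONEST FRAMING. TOOL theorems only (no definition, no named fact, no `sorry`); nothing is closed or booked; BSD is not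
proved by any of this. Seat `bsd-line-edix-p4` g9 (route `EdixhovenFibreFiveSeven`, crux K★ stmt-BirchSwinnertonDyer-22226, line
`kato-lever`, lane (g) = memo `Cruxes/StarredOptimalManinUnitFiveSeven/Lines/kato-lever-hDR-programme.md` v3.1 §3 (g)).

WHY. The tame-twist lever of seats bsd-wall-manin-p1 g3/g4 (`ManinFrameResidueProperRTameTwist.*57`, files
`AdditiveKolyvaginRoadManinFrameResidueProperRTameTwist{Character57,Symbols57,Full57}`) takes Kato's Néron integrality as the
UNIVERSAL cite-only fact F″ `kato_neron_isIntegral_twistedSymbolSum_of_additive_five_le` (binder `hK`) but APPLIES it only at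
the one curve `W` under discussion (`hK W f hf p …`). The per-class assembly `KatoAssemblySocketAt.katoNeronBody_of_sl2NeronValues_of_isDeRhamAt`
(sibling file `…AssemblyAt`) proves exactly that instance — the BODY of F″ at `(W, p)` — from P1 ∧ (S5b-tower) ∧ Prop. 1.2.3 ∧
the de Rham-ness of `V_pW|_{Γ_{ℚ_p}}` of THIS `W` (a tree theorem on the (G)-ordinary locus). These files re-key the lever on
the PER-CURVE hypothesis `hK : <body of F″ at (W, p)>` (18 displayed lines, F″'s text with `V := W` and `p` fixed); every
proof is the parent's VERBATIM with `hK W f hf p` ↦ `hK f hf` (and the `_at` names).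

* `pint_im_cuspSymbol_of_adjustable57_at`, `pint_im_cuspSymbol57_at` — `ManinFrameResidueProperRTameTwist.pint_im_cuspSymbol_of_adjustable57`
  / `pint_im_cuspSymbol57` per curve.

References: [Kato2004Asterisque] (8.1.3) p. 180, Thm. 9.7 p. 189; [KimNakamura2020] Cor. 2.4; [KostersPannekoek2017] Thm. 1;
[Manin1972] Thm. 1.6; parent file's module docstring.
-/

set_option autoImplicit false
-- the Theorems namespace of a single-conjunct summit repeats the summit name by design (D-0017)
set_option linter.dupNamespace false

noncomputable section

open scoped Classical MatrixGroups

open WeierstrassCurve NumberField Literature.NumberTheory.EllipticCurves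
  Literature.NumberTheory.EllipticCurves.ModularForms
  Literature.NumberTheory.EllipticCurves.Rank1Residual
  Literature.NumberTheory.DiophantineGeometry IsDedekindDomain Rat.HeightOneSpectrum
  Summit.BirchSwinnertonDyer.Rank1Residual Summit.BirchSwinnertonDyer.Rank1Residual.Additive
  CongruenceSubgroup Complex
  Summit.BirchSwinnertonDyer.BirchSwinnertonDyer.Theorems.ManinFrameResidueProperRTameTwist

namespace Summit.BirchSwinnertonDyer.BirchSwinnertonDyer.Theorems.ManinFrameResidueProperRTameTwistAt

section Symbols57

variable {W : WeierstrassCurve ℚ} [W.IsElliptic] {N : ℕ} [NeZero N] {p : ℕ} [hp : Fact p.Prime]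

/-- **One 57-adjustable `γ`.** Under the hypotheses of `pint_twistedSymbolSum_div57_at` (the `p ≥ 5` fact,
additive `p ≥ 5`, `Irr`, `p > 7 ∨ W(ℚ_p)[p] = 0`, `p² ∣ N`, `a_ℓ = ±1`), for `γ = (a b; c d)` L-adjustable
(g3: `c ≠ 0`, `p ∤ d − 1`, `r ∤ d − 1` for odd `r ∣ p − 1` with `r ∣ c`, `4 ∣ c → d ≡ 3 (4)`, the resonant
quadratic-residue prescriptions) AND with `−d` a square modulo `p` (or `p > 7`): `Im {∞, γ∞}_f / |Ω⁻(W)|` is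
`p`-integral. Proof = g3's `pint_im_cuspSymbol_of_adjustableL` verbatim with `p` added to the set of primes
whose residue symbol is transported to the auxiliary prime `d′` (`…RTameTwistLegendre`), so that `p` is a square
mod `d′`. [cite: Manin1972, Prop. 1.4 / Thm. 1.6] [cite: Kato2004Asterisque, Thm. 9.7 (p. 189)] -/
theorem pint_im_cuspSymbol_of_adjustable57_at
    (hK : ∀ {M : ℕ} [NeZero M] (g : CuspForm (Gamma0 M) 2), IsNewformOf W g → 5 ≤ p →
      ¬ W.HasGoodReductionAtPrime p → ¬ W.HasMultiplicativeReductionAtPrime p →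
      W.HasIrreducibleModPGaloisRep p → ∀ (m : ℕ) [NeZero m], m.Coprime (p * M) →
      (7 < p ∨ (Nat.Coprime (orderOf (p : ZMod m)) (p - 1) ∧
        ∀ P : (W.baseChange ℚ_[p]).toAffine.Point, p • P = 0 → P = 0)) →
      ∀ (χ : DirichletCharacter ℂ m), χ.IsPrimitive → χ ≠ 1 → ¬ p ∣ orderOf χ → ∀ (ϖ : ℚ) (r : ℂ),
      (χ.Even → (ϖ : ℝ) * W.realPeriodRat = plusPeriod g →
        (∏ ℓ ∈ M.primeFactors with ¬ ℓ ^ 2 ∣ M,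
            (((ℓ : ℂ) - (W.LFunction ℓ : ℂ) * χ (ℓ : ZMod m)) *
              ((ℓ : ℂ) - (W.LFunction ℓ : ℂ) * (χ (ℓ : ZMod m))⁻¹))) *
            twistedSymbolSum g χ = r * (plusPeriod g : ℂ) →
        ∃ s : ℕ, ¬ p ∣ s ∧ IsIntegral ℤ ((s : ℂ) * ϖ * r)) ∧
      (χ.Odd → (ϖ : ℝ) * W.imaginaryPeriodRat = minusPeriod g →
        (∏ ℓ ∈ M.primeFactors with ¬ ℓ ^ 2 ∣ M,
            (((ℓ : ℂ) - (W.LFunction ℓ : ℂ) * χ (ℓ : ZMod m)) *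
              ((ℓ : ℂ) - (W.LFunction ℓ : ℂ) * (χ (ℓ : ZMod m))⁻¹))) *
            twistedSymbolSum g χ = r * (minusPeriod g : ℂ) * Complex.I →
        ∃ s : ℕ, ¬ p ∣ s ∧ IsIntegral ℤ ((s : ℂ) * ϖ * r)))
    (hp5 : 5 ≤ p) (hPT : 7 < p ∨ ∀ P : (W.baseChange ℚ_[p]).toAffine.Point, p • P = 0 → P = 0) (hadd : Addv W p) (hirr : Irr W p) (f : CuspForm (Gamma0 N) 2) (hf : IsNewformOf W f)
    (hpN : p ^ 2 ∣ N)
    (ha : ∀ ℓ ∈ N.primeFactors, ¬ ℓ ^ 2 ∣ N → W.LFunction ℓ = 1 ∨ W.LFunction ℓ = -1)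
    {ϖ : ℚ} (hϖ : (ϖ : ℝ) * W.imaginaryPeriodRat = minusPeriod f)
    (γ : Gamma0 N) (hc : (γ : SL(2, ℤ)) 1 0 ≠ 0) (hdp : ¬ (p : ℤ) ∣ (γ : SL(2, ℤ)) 1 1 - 1)
    (hdr : ∀ r : ℕ, r.Prime → r ≠ 2 → r ∣ p - 1 → (r : ℤ) ∣ (γ : SL(2, ℤ)) 1 0 →
      ¬ (r : ℤ) ∣ (γ : SL(2, ℤ)) 1 1 - 1)
    (h4γ : (4 : ℤ) ∣ (γ : SL(2, ℤ)) 1 0 → (4 : ℤ) ∣ (γ : SL(2, ℤ)) 1 1 - 3)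
    (hγp : 7 < p ∨ IsSquare (-((((γ : SL(2, ℤ)) 1 1 : ℤ)) : ZMod p)))
    (hγB : ∀ ℓ ∈ N.primeFactors, ¬ ℓ ^ 2 ∣ N → ℓ ≠ 2 →
      (((ℓ : ZMod p) / (W.LFunction ℓ : ZMod p) = 1 → ¬ IsSquare (-((((γ : SL(2, ℤ)) 1 1 : ℤ)) : ZMod ℓ))) ∧
        ((ℓ : ZMod p) / (W.LFunction ℓ : ZMod p) = -1 → IsSquare (-((((γ : SL(2, ℤ)) 1 1 : ℤ)) : ZMod ℓ))))) :
    ∃ s : ℕ, ¬ p ∣ s ∧ IsIntegral ℤ ((s : ℂ) *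
      ((((cuspSymbol f γ).im : ℝ) : ℂ) / (W.imaginaryPeriodRat : ℂ))) := by
  have hpP : p.Prime := hp.out
  have hpN1 : p ∣ N := (dvd_pow_self p two_ne_zero).trans hpN
  have hreal : ∀ n, (cuspCoeff f n).im = 0 := cuspCoeff_im_eq_zero_of_coeffField_eq_bot hf.coeffField_eq_bot
  set B : Finset ℕ := N.primeFactors.filter (fun ℓ ↦ ¬ ℓ ^ 2 ∣ N ∧ ℓ ≠ 2) with hBdef
  have hB : ∀ ℓ ∈ insert p B, ℓ.Prime ∧ ℓ ≠ 2 ∧ ℓ ∣ N := fun ℓ hℓ ↦ by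
    rcases Finset.mem_insert.mp hℓ with rfl | hℓ
    · exact ⟨hpP, by omega, hpN1⟩
    · obtain ⟨hℓN, -, hℓ2⟩ := Finset.mem_filter.mp hℓ
      exact ⟨Nat.prime_of_mem_primeFactors hℓN, hℓ2, Nat.dvd_of_mem_primeFactors hℓN⟩
  obtain ⟨k, d', hd', hNd', hd'eq, hpd', hrd', h4d', hsq⟩ :=
    exists_prime_eq_add_mul_of_adjustableL hpP hpN1 γ hc hdp hdr h4γ (insert p B) hB
  haveI : NeZero d' := ⟨hd'.ne_zero⟩
  -- `p` is a square mod `d′` (from `−d_γ` a square mod `p`), unless `p > 7`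
  have hsqp : 7 < p ∨ IsSquare ((p : ZMod d')) := by
    rcases hγp with h | h
    · exact Or.inl h
    · exact Or.inr ((hsq p (Finset.mem_insert_self p B)).1 h)
  -- the quadratic-residue facts modulo `d′` needed by `pint_twistedSymbolSum_divL`
  have hL : ∀ ℓ ∈ N.primeFactors, ¬ ℓ ^ 2 ∣ N →
      (((ℓ : ZMod p) / (W.LFunction ℓ : ZMod p) = 1 → IsSquare (-((ℓ : ZMod d')))) ∧
        ((ℓ : ZMod p) / (W.LFunction ℓ : ZMod p) = -1 → IsSquare ((ℓ : ZMod d')))) := by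
    intro ℓ hℓN hℓ2
    by_cases hℓtwo : ℓ = 2
    · -- `ℓ = 2` is never resonant for `p ≥ 5`
      subst hℓtwo
      have h3 : ((3 : ℕ) : ZMod p) ≠ 0 := by
        rw [Ne, ZMod.natCast_eq_zero_iff]; intro h; have := Nat.le_of_dvd (by norm_num) h; omega
      have h1 : ((1 : ℕ) : ZMod p) ≠ 0 := by
        rw [Ne, ZMod.natCast_eq_zero_iff]; intro h; have := Nat.le_of_dvd (by norm_num) h; omega
      push_cast at h3 h1
      rcases ha 2 hℓN hℓ2 with h | h <;> rw [h] <;> push_cast <;>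
        refine ⟨fun hu ↦ absurd hu ?_, fun hu ↦ absurd hu ?_⟩
      · rw [div_one]; intro e; apply h1; linear_combination e
      · rw [div_one]; intro e; apply h3; linear_combination e
      · rw [div_neg, div_one]; intro e; apply h3; linear_combination -e
      · rw [div_neg, div_one]; intro e; apply h1; linear_combination -e
    · have hℓB : ℓ ∈ B := Finset.mem_filter.mpr ⟨hℓN, hℓ2, hℓtwo⟩
      obtain ⟨hsq1, hsq2⟩ := hsq ℓ (Finset.mem_insert_of_mem hℓB)
      obtain ⟨hγ1, hγ2⟩ := hγB ℓ hℓN hℓ2 hℓtwo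
      exact ⟨fun hu ↦ hsq2 (hγ1 hu), fun hu ↦ hsq1 (hγ2 hu)⟩
  -- `δ = γ T^k`: same first column, lower-right entry `d′`
  set δ : Gamma0 N := γ * ⟨ModularGroup.T ^ k, Literature.NumberTheory.Automorphic.T_zpow_mem_Gamma0 k⟩
    with hδdef
  obtain ⟨h00, h10, h01, h11⟩ := entries_mul_T_zpow (γ : SL(2, ℤ)) k
  have hδ : (δ : SL(2, ℤ)) = (γ : SL(2, ℤ)) * ModularGroup.T ^ k := rfl
  have hd11 : ((δ : SL(2, ℤ)) 1 1 : ℤ) = d' := by rw [hδ, h11, hd'eq]; ring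
  have hcs : cuspSymbol f δ = cuspSymbol f γ := by
    simp only [cuspSymbol, hδ, h00, h10]
  obtain ⟨b', hb'def⟩ : ∃ b' : ℤ, b' = (δ : SL(2, ℤ)) 0 1 := ⟨_, rfl⟩
  -- Manin: `{∞, b′/d′} = {∞, δ∞} + {∞, 0}`
  have hne : (((δ : SL(2, ℤ)) 1 0 : ℤ) : ℚ) * 0 + (((δ : SL(2, ℤ)) 1 1 : ℤ) : ℚ) ≠ 0 := by
    rw [mul_zero, zero_add, hd11]; exact_mod_cast hd'.ne_zero
  have hM := modularSymbol_gamma0_smul_holds f δ 0 hne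
  rw [mul_zero, zero_add, mul_zero, zero_add, hd11, hcs, ← hb'def, Int.cast_natCast] at hM
  -- `b′` is a unit mod `d′`
  have hbu : IsUnit ((b' : ZMod d')) := by
    rw [ZMod.coe_int_isUnit_iff_isCoprime]
    refine ⟨(δ : SL(2, ℤ)) 0 0, -(δ : SL(2, ℤ)) 1 0, ?_⟩
    have hdet := entry_det δ
    rw [hd11, ← hb'def] at hdet
    linear_combination hdet
  -- the odd-character identity, divided by `|Ω⁻| i`
  have hid := two_mul_sum_odd_twistedSymbolSum hd' f hreal b' hbu
  rw [hM, Complex.sub_conj] at hid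
  -- each summand divided by `Ω i` is `p`-integral
  have hΩ : 0 < W.imaginaryPeriodRat := W.imaginaryPeriodRat_pos
  have hΩ0 : (W.imaginaryPeriodRat : ℂ) ≠ 0 := by exact_mod_cast hΩ.ne'
  have hsum : ∃ s : ℕ, ¬ p ∣ s ∧ IsIntegral ℤ ((s : ℂ) *
      ∑ χ ∈ (Finset.univ : Finset (DirichletCharacter ℂ d')) with χ.Odd,
        χ ((b' : ZMod d'))⁻¹ * (twistedSymbolSum f χ / ((W.imaginaryPeriodRat : ℂ) * I))) := by
    refine pint_sum hpP _ _ fun χ hχ ↦ pint_mul hpP (pint_of_isIntegral hpP (isIntegral_apply hd' χ _)) ?_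
    exact pint_twistedSymbolSum_div57_at hK hp5 hPT hadd hirr f hf hpN ha hd' hNd' hpd' hrd' h4d' hsqp hL hϖ χ
      (Finset.mem_filter.mp hχ).2
  -- rewrite the sum as `(d′−1) · Im/Ω`
  have hsum_eq : ∑ χ ∈ (Finset.univ : Finset (DirichletCharacter ℂ d')) with χ.Odd,
      χ ((b' : ZMod d'))⁻¹ * (twistedSymbolSum f χ / ((W.imaginaryPeriodRat : ℂ) * I)) =
      ((d' - 1 : ℕ) : ℂ) * ((((cuspSymbol f γ + modularSymbol f 0).im : ℝ) : ℂ) /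
        (W.imaginaryPeriodRat : ℂ)) := by
    have h2 : (2 : ℂ) ≠ 0 := two_ne_zero
    simp_rw [← mul_div_assoc, ← Finset.sum_div]
    rw [show ∑ χ ∈ (Finset.univ : Finset (DirichletCharacter ℂ d')) with χ.Odd,
        χ ((b' : ZMod d'))⁻¹ * twistedSymbolSum f χ =
        ((d' - 1 : ℕ) : ℂ) * ((2 * (cuspSymbol f γ + modularSymbol f 0).im : ℝ) : ℂ) * I / 2 by
      rw [eq_div_iff h2, mul_comm _ (2 : ℂ), hid]; ring]
    push_cast
    field_simp
  rw [hsum_eq] at hsum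
  have him0 : (modularSymbol f 0).im = 0 := by
    have := modularSymbol_neg_eq_conj_holds f hreal 0
    rw [neg_zero] at this
    exact Complex.conj_eq_iff_im.mp this.symm
  rw [Complex.add_im, him0, add_zero] at hsum
  exact pint_of_pint_natCast_mul hpP hpd' hsum


/-- **Every `γ ∈ Γ₀(N)` at `p ∈ {5, 7}`, off the Kosters–Pannekoek exception**: `Im {∞, γ∞}_f / |Ω⁻(W)|` is
`p`-integral — `γ⁴ = γ₁ γ₂` with 57-adjustable `γᵢ` (`…RTameTwistSplit57`: residues prescribed at the resonant
`ℓ ≡ ±a_ℓ (mod p)` and `−d_{γᵢ}` a square mod `p`), `{∞, ·∞}_f` a homomorphism, `p ∤ 4`. Proof = g3's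
`pint_im_cuspSymbolL` verbatim with the 57-splitting. [cite: Manin1972, Prop. 1.4 / Thm. 1.6] -/
theorem pint_im_cuspSymbol57_at
    (hK : ∀ {M : ℕ} [NeZero M] (g : CuspForm (Gamma0 M) 2), IsNewformOf W g → 5 ≤ p →
      ¬ W.HasGoodReductionAtPrime p → ¬ W.HasMultiplicativeReductionAtPrime p →
      W.HasIrreducibleModPGaloisRep p → ∀ (m : ℕ) [NeZero m], m.Coprime (p * M) →
      (7 < p ∨ (Nat.Coprime (orderOf (p : ZMod m)) (p - 1) ∧
        ∀ P : (W.baseChange ℚ_[p]).toAffine.Point, p • P = 0 → P = 0)) →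
      ∀ (χ : DirichletCharacter ℂ m), χ.IsPrimitive → χ ≠ 1 → ¬ p ∣ orderOf χ → ∀ (ϖ : ℚ) (r : ℂ),
      (χ.Even → (ϖ : ℝ) * W.realPeriodRat = plusPeriod g →
        (∏ ℓ ∈ M.primeFactors with ¬ ℓ ^ 2 ∣ M,
            (((ℓ : ℂ) - (W.LFunction ℓ : ℂ) * χ (ℓ : ZMod m)) *
              ((ℓ : ℂ) - (W.LFunction ℓ : ℂ) * (χ (ℓ : ZMod m))⁻¹))) *
            twistedSymbolSum g χ = r * (plusPeriod g : ℂ) →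
        ∃ s : ℕ, ¬ p ∣ s ∧ IsIntegral ℤ ((s : ℂ) * ϖ * r)) ∧
      (χ.Odd → (ϖ : ℝ) * W.imaginaryPeriodRat = minusPeriod g →
        (∏ ℓ ∈ M.primeFactors with ¬ ℓ ^ 2 ∣ M,
            (((ℓ : ℂ) - (W.LFunction ℓ : ℂ) * χ (ℓ : ZMod m)) *
              ((ℓ : ℂ) - (W.LFunction ℓ : ℂ) * (χ (ℓ : ZMod m))⁻¹))) *
            twistedSymbolSum g χ = r * (minusPeriod g : ℂ) * Complex.I →
        ∃ s : ℕ, ¬ p ∣ s ∧ IsIntegral ℤ ((s : ℂ) * ϖ * r)))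
    (hp57 : p = 5 ∨ p = 7) (hPT : 7 < p ∨ ∀ P : (W.baseChange ℚ_[p]).toAffine.Point, p • P = 0 → P = 0) (hadd : Addv W p) (hirr : Irr W p) (f : CuspForm (Gamma0 N) 2) (hf : IsNewformOf W f)
    (hpN : p ^ 2 ∣ N)
    (ha : ∀ ℓ ∈ N.primeFactors, ¬ ℓ ^ 2 ∣ N → W.LFunction ℓ = 1 ∨ W.LFunction ℓ = -1)
    {ϖ : ℚ} (hϖ : (ϖ : ℝ) * W.imaginaryPeriodRat = minusPeriod f) (γ : Gamma0 N) :
    ∃ s : ℕ, ¬ p ∣ s ∧ IsIntegral ℤ ((s : ℂ) *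
      ((((cuspSymbol f γ).im : ℝ) : ℂ) / (W.imaginaryPeriodRat : ℂ))) := by
  have hpP : p.Prime := hp.out
  have hp5 : 5 ≤ p := by rcases hp57 with rfl | rfl <;> norm_num
  have hp4 : ¬ p ∣ 4 := fun h ↦ by have := Nat.le_of_dvd four_pos h; omega
  have hpN1 : p ∣ N := (dvd_pow_self p two_ne_zero).trans hpN
  -- `{∞, γ⁴∞} = 4 {∞, γ∞}`
  have h4 : cuspSymbol f (γ ^ 4) = 4 * cuspSymbol f γ := by
    have := map_pow (cuspSymbolHom f) γ 4
    simp only [cuspSymbolHom_apply] at this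
    have h := congrArg Multiplicative.toAdd this
    rw [toAdd_ofAdd, toAdd_pow, toAdd_ofAdd, nsmul_eq_mul, Nat.cast_ofNat] at h
    exact h
  have hcoe : ((γ ^ 4 : Gamma0 N) : SL(2, ℤ)) = (γ : SL(2, ℤ)) ^ 4 := rfl
  by_cases hc4 : ((γ ^ 4 : Gamma0 N) : SL(2, ℤ)) 1 0 = 0
  · -- `c(γ⁴) = 0`: the symbol vanishes
    have h0 : cuspSymbol f (γ ^ 4) = 0 := by simp only [cuspSymbol, hc4, if_true]
    rw [h4] at h0
    have : cuspSymbol f γ = 0 := by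
      rcases mul_eq_zero.mp h0 with h | h
      · norm_num at h
      · exact h
    rw [this, Complex.zero_im, Complex.ofReal_zero, zero_div]
    exact pint_of_isIntegral hpP isIntegral_zero
  · have h3 : 3 ∣ p - 1 → (3 : ℤ) ∣ ((γ ^ 4 : Gamma0 N) : SL(2, ℤ)) 1 0 →
        (3 : ℤ) ∣ ((γ ^ 4 : Gamma0 N) : SL(2, ℤ)) 1 1 - 1 := fun _ h ↦ by
      rw [hcoe] at h ⊢; exact three_dvd_pow_four_entry _ h
    have h4' : (4 : ℤ) ∣ ((γ ^ 4 : Gamma0 N) : SL(2, ℤ)) 1 0 →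
        (4 : ℤ) ∣ ((γ ^ 4 : Gamma0 N) : SL(2, ℤ)) 1 1 - 1 := fun h ↦ by
      rw [hcoe] at h ⊢; exact four_dvd_pow_four_entry _ h
    -- the resonant primes and the residue prescription `Q ℓ := (ℓ ≡ −a_ℓ mod p)`
    set B : Finset ℕ := N.primeFactors.filter (fun ℓ ↦ ¬ ℓ ^ 2 ∣ N ∧ ℓ ≠ 2 ∧
      ((ℓ : ZMod p) / (W.LFunction ℓ : ZMod p) = 1 ∨ (ℓ : ZMod p) / (W.LFunction ℓ : ZMod p) = -1)) with hBdef
    have hγc : ∀ ℓ ∈ N.primeFactors, (ℓ : ℤ) ∣ (γ : SL(2, ℤ)) 1 0 := fun ℓ hℓ ↦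
      (Int.natCast_dvd_natCast.mpr (Nat.dvd_of_mem_primeFactors hℓ)).trans (natCast_dvd_entry10 γ)
    have hγ4c : ∀ ℓ ∈ N.primeFactors, (ℓ : ℤ) ∣ ((γ ^ 4 : Gamma0 N) : SL(2, ℤ)) 1 0 := fun ℓ hℓ ↦
      (Int.natCast_dvd_natCast.mpr (Nat.dvd_of_mem_primeFactors hℓ)).trans (natCast_dvd_entry10 _)
    have hB : ∀ ℓ ∈ B, ℓ.Prime ∧ p < ℓ ∧ (ℓ : ℤ) ∣ ((γ ^ 4 : Gamma0 N) : SL(2, ℤ)) 1 0 := by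
      intro ℓ hℓ
      obtain ⟨hℓN, hℓ2, hℓtwo, hu⟩ := Finset.mem_filter.mp hℓ
      have hℓp := Nat.prime_of_mem_primeFactors hℓN
      refine ⟨hℓp, ?_, hγ4c ℓ hℓN⟩
      -- `ℓ ≡ ±a_ℓ (mod p)` with `a_ℓ = ±1` forces `ℓ > p`
      have hℓne : ℓ ≠ p := by rintro rfl; exact hℓ2 hpN
      by_contra hle
      have hlt : ℓ < p := lt_of_le_of_ne (not_lt.mp hle) hℓne
      have hval : ((ℓ : ZMod p)) = 1 ∨ ((ℓ : ZMod p)) = -1 := by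
        rcases ha ℓ hℓN hℓ2 with h | h <;> rw [h] at hu <;> push_cast at hu
        · simpa using hu
        · rw [div_neg, div_one] at hu
          rcases hu with h1 | h1
          · right; linear_combination -h1
          · left; linear_combination -h1
      rcases hval with h1 | h1
      · have : ((ℓ : ZMod p)).val = 1 := by rw [h1, ZMod.val_one]
        rw [ZMod.val_natCast_of_lt hlt] at this
        exact hℓp.one_lt.ne' this
      · have h2 : (((ℓ + 1 : ℕ)) : ZMod p) = 0 := by push_cast; rw [h1]; ring
        rw [ZMod.natCast_eq_zero_iff] at h2
        have := Nat.le_of_dvd (Nat.succ_pos ℓ) h2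
        have hodd := hℓp.odd_of_ne_two hℓtwo
        have hpodd := hpP.odd_of_ne_two (by omega)
        rcases hodd with ⟨m, hm⟩; rcases hpodd with ⟨m', hm'⟩; omega
    have hγB4 : ∀ ℓ ∈ B, IsSquare (((((γ ^ 4 : Gamma0 N) : SL(2, ℤ)) 1 1 : ℤ)) : ZMod ℓ) ∧
        (((((γ ^ 4 : Gamma0 N) : SL(2, ℤ)) 1 1 : ℤ)) : ZMod ℓ) ≠ 0 := fun ℓ hℓ ↦
      pow_four_entry_isSquare γ (hB ℓ hℓ).1 (hγc ℓ (Finset.mem_filter.mp hℓ).1)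
    have hN0 : N ≠ 0 := NeZero.ne N
    have hd4p : ∃ d0 : ZMod p, d0 ≠ 0 ∧ ((((γ ^ 4 : Gamma0 N) : SL(2, ℤ)) 1 1 : ℤ) : ZMod p) = d0 ^ 4 :=
      pow_four_entry_eq_pow_four γ hpP (hγc p (Nat.mem_primeFactors.mpr ⟨hpP, hpN1, hN0⟩))
    obtain ⟨γ₁, γ₂, hmul, ⟨hc₁, hd₁, hr₁, h4₁⟩, ⟨hc₂, hd₂, hr₂, h4₂⟩, hBout, hsq₁, hsq₂⟩ :=
      exists_eq_mul_adjustable57 hpP hp57 hpN1 (γ ^ 4) hc4 hd4p h3 h4' B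
        (fun ℓ ↦ (ℓ : ZMod p) / (W.LFunction ℓ : ZMod p) = -1) hB hγB4
    have hm1 : (1 : ZMod p) ≠ -1 := by
      intro h
      have : ((2 : ℕ) : ZMod p) = 0 := by push_cast; linear_combination h
      rw [ZMod.natCast_eq_zero_iff] at this
      have := Nat.le_of_dvd two_pos this; omega
    have hγB₁ : ∀ ℓ ∈ N.primeFactors, ¬ ℓ ^ 2 ∣ N → ℓ ≠ 2 →
        (((ℓ : ZMod p) / (W.LFunction ℓ : ZMod p) = 1 → ¬ IsSquare (-((((γ₁ : SL(2, ℤ)) 1 1 : ℤ)) : ZMod ℓ))) ∧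
          ((ℓ : ZMod p) / (W.LFunction ℓ : ZMod p) = -1 → IsSquare (-((((γ₁ : SL(2, ℤ)) 1 1 : ℤ)) : ZMod ℓ)))) := by
      intro ℓ hℓN hℓ2 hℓtwo
      refine ⟨fun hu ↦ ?_, fun hu ↦ ?_⟩
      · have hℓB : ℓ ∈ B := Finset.mem_filter.mpr ⟨hℓN, hℓ2, hℓtwo, Or.inl hu⟩
        exact (hBout ℓ hℓB).1.2 (by rw [hu]; exact hm1)
      · have hℓB : ℓ ∈ B := Finset.mem_filter.mpr ⟨hℓN, hℓ2, hℓtwo, Or.inr hu⟩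
        exact (hBout ℓ hℓB).1.1 hu
    have hγB₂ : ∀ ℓ ∈ N.primeFactors, ¬ ℓ ^ 2 ∣ N → ℓ ≠ 2 →
        (((ℓ : ZMod p) / (W.LFunction ℓ : ZMod p) = 1 → ¬ IsSquare (-((((γ₂ : SL(2, ℤ)) 1 1 : ℤ)) : ZMod ℓ))) ∧
          ((ℓ : ZMod p) / (W.LFunction ℓ : ZMod p) = -1 → IsSquare (-((((γ₂ : SL(2, ℤ)) 1 1 : ℤ)) : ZMod ℓ)))) := by
      intro ℓ hℓN hℓ2 hℓtwo
      refine ⟨fun hu ↦ ?_, fun hu ↦ ?_⟩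
      · have hℓB : ℓ ∈ B := Finset.mem_filter.mpr ⟨hℓN, hℓ2, hℓtwo, Or.inl hu⟩
        exact (hBout ℓ hℓB).2.2 (by rw [hu]; exact hm1)
      · have hℓB : ℓ ∈ B := Finset.mem_filter.mpr ⟨hℓN, hℓ2, hℓtwo, Or.inr hu⟩
        exact (hBout ℓ hℓB).2.1 hu
    have hP₁ := pint_im_cuspSymbol_of_adjustable57_at hK hp5 hPT hadd hirr f hf hpN ha hϖ γ₁ hc₁ hd₁ hr₁ h4₁
      (Or.inr hsq₁) hγB₁
    have hP₂ := pint_im_cuspSymbol_of_adjustable57_at hK hp5 hPT hadd hirr f hf hpN ha hϖ γ₂ hc₂ hd₂ hr₂ h4₂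
      (Or.inr hsq₂) hγB₂
    have hsum : cuspSymbol f γ₁ + cuspSymbol f γ₂ = 4 * cuspSymbol f γ := by
      rw [← h4, hmul, cuspSymbol_mul_holds f]
    have him : (((cuspSymbol f γ₁).im : ℝ) : ℂ) / (W.imaginaryPeriodRat : ℂ) +
        (((cuspSymbol f γ₂).im : ℝ) : ℂ) / (W.imaginaryPeriodRat : ℂ) =
        ((4 : ℕ) : ℂ) * ((((cuspSymbol f γ).im : ℝ) : ℂ) / (W.imaginaryPeriodRat : ℂ)) := by
      have := congrArg Complex.im hsum
      rw [Complex.add_im] at this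
      rw [← add_div, ← Complex.ofReal_add, this]
      simp [Complex.mul_im]
      ring
    refine pint_of_pint_natCast_mul hpP hp4 ?_
    rw [← him]
    exact pint_add hpP hP₁ hP₂





end Symbols57

end Summit.BirchSwinnertonDyer.BirchSwinnertonDyer.Theorems.ManinFrameResidueProperRTameTwistAt

end
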